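import Summits.BirchSwinnertonDyer.BirchSwinnertonDyer.Theorems.PrintX8SmallImageMuReading
import Summits.BirchSwinnertonDyer.BirchSwinnertonDyer.Theses.PrintX8
import HarnessLib

/-!
# Route `PrintX8`, crux `SharpFlatMainConjectureSmallImageX8` (stmt-BirchSwinnertonDyer-20402) — the
# CLASS FORMS of the `μ`-reading: 20402 ⟺ (K1's predicate on the small-image pairs) ∧ (a `μ`-bound on
# them), modulo Sprung 2012 Thms. 7.14 / 7.16 and the period unit at `3`; and C1 image-free from K1 + a
# `μ`-bound (cell `bsd-print-x8`, D-0131 (2) print tier, prover seat p3; `--supports` 20402, closes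
# nothing)

PARTITION (cell bsd-print-x8, leaf `ClassX8` = K3 row A8 = W-ALL row 8; 217 census cells, 61 of them
with image `N_ns(3)` = ty3's `x8_smallimage_61cells.tsv`): types-the-object-of the small-image crux of
route `PrintX8` as a CLASS statement; closes NONE; 0 census cells move; BSD is not proved by any of this.

HONEST FRAMING. File A (`PrintX8SmallImageMuReading.lean`, p539576) proved PER PAIR, on every X8 pair
and GIVEN K1's predicate, that `char X^• = (3^m · L^•_3(E))` and that Sprung's Main Conjecture 7.21 for
`•` is the `μ`-inequality `μ(X^•) ≤ μ(Λ/(L^•))`. THIS file quantifies it over the class, in the exact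
binder order of the route's decls (`Theses/PrintX8.lean` rev 6), so that the tenure planner can read —
or split — the crux BY NAME:

* `sharpFlatMainConjectureSmallImageX8_of_sprungLowerDivisibilityAtThree_of_muBound` — **20402 ⟸ K1
  (`Theses.PrintX8.SprungLowerDivisibilityAtThree`, item 19875) + the `μ`-BOUND on the small-image X8
  pairs of analytic rank `≤ 1`** («for every cyclotomic/Honda/newform/Sprung-pair datum,
  `μ(X^•(E/ℚ_∞)) ≤ μ(Λ/(L^•_3(E)))`», displayed `ϖ`-free), modulo Sprung 2012 Thm. 7.14, Thm. 7.16
  (first clause) and the period unit at `3`; `…_of_publishedInputs_of_K1_of_muBound` reads the three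
  facts off the route's `PublishedInputsX8` (conjuncts 4, 5, 7); `…_of_muInvariant_eq_zero` is the
  `μ = 0` form (the ♯/♭ `μ = 0` statement at the irreducible `E[3]`).
* `muInvariant_eq_smallImage_of_sharpFlatMainConjectureSmallImageX8` — conversely 20402 ⇒ the
  `μ`-EQUALITY on those pairs (no K1);
* `sharpFlatMainConjectureSmallImageX8_iff_lowerDivisibility_and_muBound` — **THE SPLIT: modulo the
  three facts, 20402 ⟺ (K1's predicate on the small-image pairs of rank `≤ 1`) ∧ (the `μ`-bound
  there)**: beyond K1, the 61 `N_ns(3)` cells lack ONE inequality of `μ`-invariants per pair and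
  colour — not a divisibility of power series;
* `sharpFlatMainConjectureX8_of_sprungLowerDivisibilityAtThree_of_muBound` — C1 (stmt-20304)
  IMAGE-FREE: K1 + the `μ`-bound on ALL X8 pairs of rank `≤ 1` ⇒ the ♯/♭ main conjecture on X8, with NO
  `surj(3)` case split and no Wuthrich/Kato-image input — the Galois image enters Main Conjecture 7.21
  on X8 only through `μ` (on the big-image branch the `μ`-equality is a theorem given K1: compose
  p534029's `X8.sprungSharpFlatMainConjecture_of_lowerDivisibility_of_surj` with file A's
  `X8.muInvariant_eq_of_sprungSharpFlatMainConjecture`).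
The rank-`0` identification «`μ`-bound ⟺ `BSD(E,3)`» is the sibling `PrintX8SmallImageRankZero.lean`.
PRINT STATUS of the `μ`-bound at `a_3 = ±3` (presearch 2026-08-27): NOT in print. What exists: (i) the
`μ`-part of Kato's divisibility needs (12.5.2) (Sprung 2012 Thm. 7.16 `n = 0` clause), unavailable at
image `N_ns(3)`; (ii) ♯/♭ (Wach-module signed) `μ`/`λ`-transfer between `p`-congruent non-ordinary forms
— Hatley–Lei, Ann. Inst. Fourier 69 (2019) — moves `μ = 0` only between curves sharing `ρ̄_{E,3}`, hence
sharing the small image; a transfer engine would need a PARTNER with `μ(X^•) = 0` known for another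
reason (e.g. `char X^• = Λ` from a `3`-adic unit `L`-value via Sprung 2024 Lemma 5.9) — research, not
print. Beyond-print theorem: NO (compositions modulo named facts and K1). PARTITION: 0 cells.

References: [Sprung2012] Thm. 7.14, 7.16, Main Conj. 7.21 (pp. 1504–1505); [Wuthrich2014] Lemma 20;
[Kato2004] (12.5.2); [Washington1997] §13.2; [GreenbergVatsal2000] p. 2; [HatleyLei2019] (context only);
files `Theorems/PrintX8SmallImageMuReading.lean` (p539576), `Theses/PrintX8.lean` (rev 6),
`Theorems/SignedLowerHalvesSprungLowerDivisibilityAtThreeSurjBranch.lean` (p534029).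
-/

set_option autoImplicit false
-- justification: the mandated namespace `Summit.BirchSwinnertonDyer.BirchSwinnertonDyer.Theorems`
-- (single-conjunct summit, Sub = Summit) repeats a segment by design (D-0017).
set_option linter.dupNamespace false

noncomputable section

open scoped Classical NumberField MatrixGroups ModularForm
open NumberField IsDedekindDomain WeierstrassCurve CongruenceSubgroup
  Literature.NumberTheory.EllipticCurves Literature.NumberTheory.EllipticCurves.ModularForms
  Literature.NumberTheory.EllipticCurves.Rank1Residual
  Literature.NumberTheory.EllipticCurves.Rank1Residual.Typed
  Literature.NumberTheory.EllipticCurves.Sprung2017 Literature.NumberTheory.EllipticCurves.Sprung2012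
  Literature.NumberTheory.EllipticCurves.Sprung2024
  Literature.NumberTheory.EllipticCurves.ZpExtension
  Summit.BirchSwinnertonDyer.BirchSwinnertonDyer.Theorems
  Summit.BirchSwinnertonDyer.BirchSwinnertonDyer.Theorems.PrintX8MuReading

namespace Summit.BirchSwinnertonDyer.BirchSwinnertonDyer.Theorems.PrintX8MuSplit

open Summit.BirchSwinnertonDyer Summit.BirchSwinnertonDyer.Rank1Residual.Supersingular
  Literature.NumberTheory.EllipticCurves.BurungaleTian2026

/-! ### §2. Class forms for route `PrintX8`: the small-image crux (stmt-20402) ⟸ / ⟺ K1 + a `μ`-bound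
on the 61 `N_ns(3)` pairs — the typed split «20402 = (Eisenstein half) ∧ (`μ`-bound)» modulo print -/

section ClassForms

/-- **20402 ⟸ 19875 + `μ`-bound.** Granted Sprung 2012 Thms. 7.14 / 7.16 (first clause) and the period
unit at `3` BY NAME: the K3 crux child K1 `SprungLowerDivisibilityAtThree` (route `PrintX8`'s copy,
item stmt-BirchSwinnertonDyer-19875) together with the displayed `μ`-BOUND on the small-image X8 pairs of
analytic rank `≤ 1` — «`μ(X^•(E/ℚ_∞)) ≤ μ(Λ/(L^•_3(E)))` for every cyclotomic/Honda/newform/Sprung-pair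
datum» — gives the crux `SharpFlatMainConjectureSmallImageX8` (item stmt-BirchSwinnertonDyer-20402).
CONDITIONAL (K1 open; the `μ`-bound open); closes nothing; the glue of a candidate split of 20402.
[cite: Sprung2012, Thm. 7.14, Thm. 7.16 (p. 1504) and Main Conj. 7.21 (p. 1505)] [cite: Washington1997, §13.2] -/
theorem sharpFlatMainConjectureSmallImageX8_of_sprungLowerDivisibilityAtThree_of_muBound
    (h714 : thm714_sharpFlatSelmerDual_finite_torsion)
    (h716 : thm716_sharpFlatCharIdeal_divisibility)
    (h3 : realPeriodRat_eq_unit_mul_plusPeriod_three)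
    (hK1 : Theses.PrintX8.SprungLowerDivisibilityAtThree)
    (hμ : ∀ (W : WeierstrassCurve ℚ) [W.IsElliptic] [W.IsGloballyMinimal] (p : ℕ) [Fact p.Prime],
        ClassX8 W p → ¬ Surj W p → W.analyticRank ≤ 1 → ∀ col : Chroma,
        ∀ (κ : ZpExtension ℚ p) (γ : Field.absoluteGaloisGroup ℚ),
            κ.IsCyclotomic → κ.IsTopGenerator γ → IsCyclotomicVariable p γ →
          ∀ (v : HeightOneSpectrum (𝓞 ℚ)), (p : 𝓞 ℚ) ∈ v.asIdeal →
          ∀ (g : Field.absoluteGaloisGroup (v.adicCompletion ℚ)),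
            κ.IsTopGenerator (resGalOfEmb (closureEmb (K := ℚ) (v.adicCompletion ℚ)) g) →
          ∀ (cneg : localPoints W (v.adicCompletion ℚ)) (c : ℕ → localPoints W (v.adicCompletion ℚ)),
            IsHondaSystem κ (closureEmb (K := ℚ) (v.adicCompletion ℚ)) W (W.frobeniusTrace p) g cneg c →
          ∀ (N : ℕ) (_ : NeZero N) (f : CuspForm (Gamma0 N) 2) (Lsharp Lflat : IwasawaAlgebra p),
            IsNewformOf W f → IsSprungPair f p (W.frobeniusTrace p) Lsharp Lflat →
            chromaticL col Lsharp Lflat ≠ 0 →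
          ∀ D : SharpFlatSelmerDualData W κ γ (closureEmb (K := ℚ) (v.adicCompletion ℚ))
              (W.frobeniusTrace p) g c col,
            muInvariant p D.X ≤ muInvariant p (IwasawaAlgebra p ⧸ Ideal.span {chromaticL col Lsharp Lflat})) :
    Theses.PrintX8.SharpFlatMainConjectureSmallImageX8 := by
  intro W _ _ p _ hX hns hr col
  exact X8.sprungSharpFlatMainConjecture_of_lowerDivisibility_of_muInvariant_le h714 h716 h3 W p hX col
    (hK1 W p hX col) (hμ W p hX hns hr col)

/-- **The same over the route's by-name conjunction `PublishedInputsX8`** (conjuncts 4, 5, 7: Sprung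
2012 Thm. 7.14, Thm. 7.16, period unit at `3`). [cite: Sprung2012, Thm. 7.14, Thm. 7.16 (p. 1504) and Main Conj. 7.21 (p. 1505)] -/
theorem sharpFlatMainConjectureSmallImageX8_of_publishedInputs_of_K1_of_muBound
    (hPub : Theses.PrintX8.PublishedInputsX8) (hK1 : Theses.PrintX8.SprungLowerDivisibilityAtThree)
    (hμ : ∀ (W : WeierstrassCurve ℚ) [W.IsElliptic] [W.IsGloballyMinimal] (p : ℕ) [Fact p.Prime],
        ClassX8 W p → ¬ Surj W p → W.analyticRank ≤ 1 → ∀ col : Chroma,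
        ∀ (κ : ZpExtension ℚ p) (γ : Field.absoluteGaloisGroup ℚ),
            κ.IsCyclotomic → κ.IsTopGenerator γ → IsCyclotomicVariable p γ →
          ∀ (v : HeightOneSpectrum (𝓞 ℚ)), (p : 𝓞 ℚ) ∈ v.asIdeal →
          ∀ (g : Field.absoluteGaloisGroup (v.adicCompletion ℚ)),
            κ.IsTopGenerator (resGalOfEmb (closureEmb (K := ℚ) (v.adicCompletion ℚ)) g) →
          ∀ (cneg : localPoints W (v.adicCompletion ℚ)) (c : ℕ → localPoints W (v.adicCompletion ℚ)),
            IsHondaSystem κ (closureEmb (K := ℚ) (v.adicCompletion ℚ)) W (W.frobeniusTrace p) g cneg c →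
          ∀ (N : ℕ) (_ : NeZero N) (f : CuspForm (Gamma0 N) 2) (Lsharp Lflat : IwasawaAlgebra p),
            IsNewformOf W f → IsSprungPair f p (W.frobeniusTrace p) Lsharp Lflat →
            chromaticL col Lsharp Lflat ≠ 0 →
          ∀ D : SharpFlatSelmerDualData W κ γ (closureEmb (K := ℚ) (v.adicCompletion ℚ))
              (W.frobeniusTrace p) g c col,
            muInvariant p D.X ≤ muInvariant p (IwasawaAlgebra p ⧸ Ideal.span {chromaticL col Lsharp Lflat})) :
    Theses.PrintX8.SharpFlatMainConjectureSmallImageX8 := by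
  obtain ⟨-, -, -, h714, h716, -, h3, -⟩ := hPub
  exact sharpFlatMainConjectureSmallImageX8_of_sprungLowerDivisibilityAtThree_of_muBound h714 h716 h3
    hK1 hμ

/-- **The `μ = 0` class form: 20402 ⟸ 19875 + «`μ(X^•(E/ℚ_∞)) = 0` on the 61 small-image X8 pairs of
rank `≤ 1`»** (the ♯/♭ `μ = 0` statement at an irreducible `E[3]`), modulo Sprung 2012 Thms. 7.14 /
7.16 and the period unit at `3`. CONDITIONAL; closes nothing. [cite: Sprung2012, Thm. 7.14, Thm. 7.16 (p. 1504) and Main Conj. 7.21 (p. 1505)]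
[cite: GreenbergVatsal2000, p. 2, (1)–(2)] -/
theorem sharpFlatMainConjectureSmallImageX8_of_sprungLowerDivisibilityAtThree_of_muInvariant_eq_zero
    (h714 : thm714_sharpFlatSelmerDual_finite_torsion)
    (h716 : thm716_sharpFlatCharIdeal_divisibility)
    (h3 : realPeriodRat_eq_unit_mul_plusPeriod_three)
    (hK1 : Theses.PrintX8.SprungLowerDivisibilityAtThree)
    (hμ0 : ∀ (W : WeierstrassCurve ℚ) [W.IsElliptic] [W.IsGloballyMinimal] (p : ℕ) [Fact p.Prime],
        ClassX8 W p → ¬ Surj W p → W.analyticRank ≤ 1 → ∀ col : Chroma,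
        ∀ (κ : ZpExtension ℚ p) (γ : Field.absoluteGaloisGroup ℚ),
            κ.IsCyclotomic → κ.IsTopGenerator γ → IsCyclotomicVariable p γ →
          ∀ (v : HeightOneSpectrum (𝓞 ℚ)), (p : 𝓞 ℚ) ∈ v.asIdeal →
          ∀ (g : Field.absoluteGaloisGroup (v.adicCompletion ℚ)),
            κ.IsTopGenerator (resGalOfEmb (closureEmb (K := ℚ) (v.adicCompletion ℚ)) g) →
          ∀ (cneg : localPoints W (v.adicCompletion ℚ)) (c : ℕ → localPoints W (v.adicCompletion ℚ)),
            IsHondaSystem κ (closureEmb (K := ℚ) (v.adicCompletion ℚ)) W (W.frobeniusTrace p) g cneg c →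
          ∀ (N : ℕ) (_ : NeZero N) (f : CuspForm (Gamma0 N) 2) (Lsharp Lflat : IwasawaAlgebra p),
            IsNewformOf W f → IsSprungPair f p (W.frobeniusTrace p) Lsharp Lflat →
            chromaticL col Lsharp Lflat ≠ 0 →
          ∀ D : SharpFlatSelmerDualData W κ γ (closureEmb (K := ℚ) (v.adicCompletion ℚ))
              (W.frobeniusTrace p) g c col,
            muInvariant p D.X = 0) :
    Theses.PrintX8.SharpFlatMainConjectureSmallImageX8 := by
  intro W _ _ p _ hX hns hr col
  exact X8.sprungSharpFlatMainConjecture_of_lowerDivisibility_of_muInvariant_eq_zero h714 h716 h3 W p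
    hX col (hK1 W p hX col) (hμ0 W p hX hns hr col)

/-- **Conversely, 20402 ⇒ the `μ`-EQUALITY on the small-image X8 pairs of rank `≤ 1`** (no K1 needed;
Sprung 2012 Thm. 7.14 and the period fact at `3` by name). So, modulo print and K1, the crux 20402 IS
the displayed `μ`-statement — neither weaker nor stronger. [cite: Sprung2012, Main Conj. 7.21 (p. 1505)]
[cite: Washington1997, §13.2] -/
theorem muInvariant_eq_smallImage_of_sharpFlatMainConjectureSmallImageX8
    (h714 : thm714_sharpFlatSelmerDual_finite_torsion)
    (h3 : realPeriodRat_eq_unit_mul_plusPeriod_three)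
    (hSmall : Theses.PrintX8.SharpFlatMainConjectureSmallImageX8) :
    ∀ (W : WeierstrassCurve ℚ) [W.IsElliptic] [W.IsGloballyMinimal] (p : ℕ) [Fact p.Prime],
      ClassX8 W p → ¬ Surj W p → W.analyticRank ≤ 1 → ∀ col : Chroma,
      ∀ (κ : ZpExtension ℚ p) (γ : Field.absoluteGaloisGroup ℚ),
          κ.IsCyclotomic → κ.IsTopGenerator γ → IsCyclotomicVariable p γ →
        ∀ (v : HeightOneSpectrum (𝓞 ℚ)), (p : 𝓞 ℚ) ∈ v.asIdeal →
        ∀ (g : Field.absoluteGaloisGroup (v.adicCompletion ℚ)),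
          κ.IsTopGenerator (resGalOfEmb (closureEmb (K := ℚ) (v.adicCompletion ℚ)) g) →
        ∀ (cneg : localPoints W (v.adicCompletion ℚ)) (c : ℕ → localPoints W (v.adicCompletion ℚ)),
          IsHondaSystem κ (closureEmb (K := ℚ) (v.adicCompletion ℚ)) W (W.frobeniusTrace p) g cneg c →
        ∀ (N : ℕ) (_ : NeZero N) (f : CuspForm (Gamma0 N) 2) (Lsharp Lflat : IwasawaAlgebra p),
          IsNewformOf W f → IsSprungPair f p (W.frobeniusTrace p) Lsharp Lflat →
          chromaticL col Lsharp Lflat ≠ 0 →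
        ∀ D : SharpFlatSelmerDualData W κ γ (closureEmb (K := ℚ) (v.adicCompletion ℚ))
            (W.frobeniusTrace p) g c col,
          muInvariant p D.X = muInvariant p (IwasawaAlgebra p ⧸ Ideal.span {chromaticL col Lsharp Lflat}) :=
  fun W _ _ p _ hX hns hr col ↦
    X8.muInvariant_eq_of_sprungSharpFlatMainConjecture h714 h3 W p hX col (hSmall W p hX hns hr col)

/-- **THE SPLIT (iff).** Granted Sprung 2012 Thms. 7.14 / 7.16 (first clause) and the period unit at `3`
BY NAME, the crux `SharpFlatMainConjectureSmallImageX8` (stmt-20402) is EQUIVALENT to the conjunction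
of (a) K1's predicate `SprungSharpFlatLowerDivisibility W 3 •` on the small-image X8 pairs of analytic
rank `≤ 1` (the Eisenstein half there — a sub-statement of item 19875) and (b) the `μ`-bound
«`μ(X^•) ≤ μ(Λ/(L^•))`» on the same pairs. READING: beyond K1, what the 61 `N_ns(3)` cells lack is NOT
a divisibility of power series but ONE inequality of `μ`-invariants per pair and colour (equivalently,
by §1, the vanishing of the exponent `m` in `char X^• = (3^m L^•)`).
[cite: Sprung2012, Thm. 7.14, Thm. 7.16 (p. 1504) and Main Conj. 7.21 (p. 1505)] [cite: Washington1997, §13.2] -/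
theorem sharpFlatMainConjectureSmallImageX8_iff_lowerDivisibility_and_muBound
    (h714 : thm714_sharpFlatSelmerDual_finite_torsion)
    (h716 : thm716_sharpFlatCharIdeal_divisibility)
    (h3 : realPeriodRat_eq_unit_mul_plusPeriod_three) :
    Theses.PrintX8.SharpFlatMainConjectureSmallImageX8 ↔
      ((∀ (W : WeierstrassCurve ℚ) [W.IsElliptic] [W.IsGloballyMinimal] (p : ℕ) [Fact p.Prime],
          ClassX8 W p → ¬ Surj W p → W.analyticRank ≤ 1 →
          ∀ col : Chroma, SprungSharpFlatLowerDivisibility W p col) ∧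
        ∀ (W : WeierstrassCurve ℚ) [W.IsElliptic] [W.IsGloballyMinimal] (p : ℕ) [Fact p.Prime],
          ClassX8 W p → ¬ Surj W p → W.analyticRank ≤ 1 → ∀ col : Chroma,
          ∀ (κ : ZpExtension ℚ p) (γ : Field.absoluteGaloisGroup ℚ),
              κ.IsCyclotomic → κ.IsTopGenerator γ → IsCyclotomicVariable p γ →
            ∀ (v : HeightOneSpectrum (𝓞 ℚ)), (p : 𝓞 ℚ) ∈ v.asIdeal →
            ∀ (g : Field.absoluteGaloisGroup (v.adicCompletion ℚ)),
              κ.IsTopGenerator (resGalOfEmb (closureEmb (K := ℚ) (v.adicCompletion ℚ)) g) →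
            ∀ (cneg : localPoints W (v.adicCompletion ℚ)) (c : ℕ → localPoints W (v.adicCompletion ℚ)),
              IsHondaSystem κ (closureEmb (K := ℚ) (v.adicCompletion ℚ)) W (W.frobeniusTrace p) g cneg c →
            ∀ (N : ℕ) (_ : NeZero N) (f : CuspForm (Gamma0 N) 2) (Lsharp Lflat : IwasawaAlgebra p),
              IsNewformOf W f → IsSprungPair f p (W.frobeniusTrace p) Lsharp Lflat →
              chromaticL col Lsharp Lflat ≠ 0 →
            ∀ D : SharpFlatSelmerDualData W κ γ (closureEmb (K := ℚ) (v.adicCompletion ℚ))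
                (W.frobeniusTrace p) g c col,
              muInvariant p D.X ≤ muInvariant p (IwasawaAlgebra p ⧸ Ideal.span {chromaticL col Lsharp Lflat})) := by
  refine ⟨fun hSmall ↦ ⟨fun W _ _ p _ hX hns hr col ↦
      sprungSharpFlatLowerDivisibility_of_mainConjecture (hSmall W p hX hns hr col),
    fun W _ _ p _ hX hns hr col κ γ hκ hγ hγ' v hv g hg cneg c hc N hN f Lsharp Lflat hf hSP hcol D ↦
      (muInvariant_eq_smallImage_of_sharpFlatMainConjectureSmallImageX8 h714 h3 hSmall W p hX hns hr
        col κ γ hκ hγ hγ' v hv g hg cneg c hc N hN f Lsharp Lflat hf hSP hcol D).le⟩,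
    fun ⟨hK1s, hμ⟩ W _ _ p _ hX hns hr col ↦
      X8.sprungSharpFlatMainConjecture_of_lowerDivisibility_of_muInvariant_le h714 h716 h3 W p hX col
        (hK1s W p hX hns hr col) (hμ W p hX hns hr col)⟩

/-- **C1 `SharpFlatMainConjectureX8` (stmt-20304), IMAGE-FREE: K1 + the `μ`-bound on ALL X8 pairs of
rank `≤ 1` ⇒ the ♯/♭ main conjecture on X8** — no `surj(3)` case split, no Wuthrich/Kato-image input:
the Galois image enters Sprung's Main Conjecture 7.21 on X8 only through the `μ`-invariant. Modulo Sprung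
2012 Thms. 7.14 / 7.16 (first clause) and the period unit at `3`. CONDITIONAL; closes nothing.
[cite: Sprung2012, Thm. 7.14, Thm. 7.16 (p. 1504) and Main Conj. 7.21 (p. 1505)] [cite: Washington1997, §13.2] -/
theorem sharpFlatMainConjectureX8_of_sprungLowerDivisibilityAtThree_of_muBound
    (h714 : thm714_sharpFlatSelmerDual_finite_torsion)
    (h716 : thm716_sharpFlatCharIdeal_divisibility)
    (h3 : realPeriodRat_eq_unit_mul_plusPeriod_three)
    (hK1 : Theses.PrintX8.SprungLowerDivisibilityAtThree)
    (hμ : ∀ (W : WeierstrassCurve ℚ) [W.IsElliptic] [W.IsGloballyMinimal] (p : ℕ) [Fact p.Prime],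
        ClassX8 W p → W.analyticRank ≤ 1 → ∀ col : Chroma,
        ∀ (κ : ZpExtension ℚ p) (γ : Field.absoluteGaloisGroup ℚ),
            κ.IsCyclotomic → κ.IsTopGenerator γ → IsCyclotomicVariable p γ →
          ∀ (v : HeightOneSpectrum (𝓞 ℚ)), (p : 𝓞 ℚ) ∈ v.asIdeal →
          ∀ (g : Field.absoluteGaloisGroup (v.adicCompletion ℚ)),
            κ.IsTopGenerator (resGalOfEmb (closureEmb (K := ℚ) (v.adicCompletion ℚ)) g) →
          ∀ (cneg : localPoints W (v.adicCompletion ℚ)) (c : ℕ → localPoints W (v.adicCompletion ℚ)),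
            IsHondaSystem κ (closureEmb (K := ℚ) (v.adicCompletion ℚ)) W (W.frobeniusTrace p) g cneg c →
          ∀ (N : ℕ) (_ : NeZero N) (f : CuspForm (Gamma0 N) 2) (Lsharp Lflat : IwasawaAlgebra p),
            IsNewformOf W f → IsSprungPair f p (W.frobeniusTrace p) Lsharp Lflat →
            chromaticL col Lsharp Lflat ≠ 0 →
          ∀ D : SharpFlatSelmerDualData W κ γ (closureEmb (K := ℚ) (v.adicCompletion ℚ))
              (W.frobeniusTrace p) g c col,
            muInvariant p D.X ≤ muInvariant p (IwasawaAlgebra p ⧸ Ideal.span {chromaticL col Lsharp Lflat})) :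
    Theses.PrintX8.SharpFlatMainConjectureX8 := by
  intro W _ _ p _ hX hr col
  exact X8.sprungSharpFlatMainConjecture_of_lowerDivisibility_of_muInvariant_le h714 h716 h3 W p hX col
    (hK1 W p hX col) (hμ W p hX hr col)

end ClassForms


end Summit.BirchSwinnertonDyer.BirchSwinnertonDyer.Theorems.PrintX8MuSplit

end
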